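import Summits.NavierStokesRegularity.NavierStokesRegularity.Theorems.SqueezeCycleExtremalElementExistsRegularity
import Literature.Analysis.FluidPDE.TypeIRateOseenMildRepresentative
import Literature.Analysis.FluidPDE.TypeIAncientMild
import HarnessLib

/-!
# Crux `RecurrentLiouville` (stmt-NavierStokesRegularity-1589), line `Sketch` — stub
# `stub_satCruxOfLiouvilleL`: the crux from the KNSS Liouville conjecture (L)

Theorems-only file (no definitions, no named facts).  CONDITIONAL closure of the crux: assuming
the Liouville conjecture (L) of Koch–Nadirashvili–Seregin–Šverák 2009 / Seregin–Šverák 2009 —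
written out verbatim as in item `TypeIliouvilleL` (stmt-NavierStokesRegularity-10661) and the
canonical `Summit.NavierStokesRegularity.NavierStokesRegularity.LiouvilleConjectureNS`: every
bounded ancient mild solution (`ν = 1`) with a.e.-strongly measurable slices is slice-wise a.e.
constant — EVERY member of the crux's class (suitable weak on the backward slab, weak gradient,
Albritton–Barker `𝐈 < ⊤`, rate `‖u‖ ≤ C/√(−t)`) is regular at the origin; recurrence is not used
(so (L) gives `RecurrentProfiles.NoTypeIRateProfile`, the route's target, outright).

Proof (Albritton–Barker 2019, §1: "If true, the conjecture excludes Type I singularities"): the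
continuous Oseen-mild representative `v` of `u` (`exists_oseenMild_repr_of_typeIBound_lt_top`) is a
Type-I ancient mild field in the KNSS gauge (`isTypeIAncientMild_of_continuous_oseenMild`); its
past translates `v(· − δ)`, `δ > 0`, are bounded ancient mild solutions with continuous slices
(`IsTypeIAncientMild.isBoundedAncientMildSolution_sub`), so (L) makes every slice `v(τ, ·)`,
`τ < 0`, a.e. — hence, by continuity, everywhere — constant; the gauge kills slice-constant
Type-I fields (`IsTypeIAncientMild.eq_zero_of_slice_const`), so `v = 0` on the open slab, `u = 0`
a.e. there, and the origin is regular.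

## References

* G. Koch, N. Nadirashvili, G. Seregin, V. Šverák, Acta Math. 203 (2009) 83–105 =
  arXiv:0709.3599, §1 (conjecture (L)), Remark 6.1. [KochNadirashviliSereginSverak2009]
* D. Albritton, T. Barker, J. Math. Fluid Mech. 21 (2019) = arXiv:1811.00502, §1 after Thm. 1.1.
  [AlbrittonBarker2019]
-/

noncomputable section

-- the sub-problem namespace repeats the summit name (D-0017 layout `Summit.<S>.<P>.Theorems`)
set_option linter.dupNamespace false

namespace Summit.NavierStokesRegularity.NavierStokesRegularity.Theorems

open MeasureTheory Set Function Filter Topology TopologicalSpace Metric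
open Literature.Analysis.FluidPDE
open scoped NNReal ENNReal

/-- **Under (L), a Type-I ancient mild field in the KNSS gauge vanishes on the open slab.**  Its
past translates are bounded ancient mild solutions with continuous slices, so (L) makes every
slice a.e. constant, hence constant (continuity), and `IsTypeIAncientMild.eq_zero_of_slice_const`
kills slice-constant fields. [cite: KochNadirashviliSereginSverak2009, §1 and Remark 6.1] -/
theorem satCL_typeIAncientMild_eq_zero
    (hL : ∀ v : ℝ → EuclideanSpace ℝ (Fin 3) → EuclideanSpace ℝ (Fin 3), IsBoundedAncientMildSolution 1 v →
      (∀ t < 0, AEStronglyMeasurable (v t) volume) →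
      ∀ t < 0, ∃ b : EuclideanSpace ℝ (Fin 3), v t =ᵐ[volume] fun _ => b)
    {C : ℝ} {v : ℝ → EuclideanSpace ℝ (Fin 3) → EuclideanSpace ℝ (Fin 3)} (hv : IsTypeIAncientMild C v)
    {t : ℝ} (ht : t < 0) (x : EuclideanSpace ℝ (Fin 3)) : v t x = 0 := by
  classical
  -- every slice `v τ`, `τ < 0`, is constant
  have hconst : ∀ τ < 0, ∃ b : EuclideanSpace ℝ (Fin 3), v τ = fun _ => b := by
    intro τ hτ
    have hδ : 0 < -τ / 2 := by linarith
    have hB := hv.isBoundedAncientMildSolution_sub hδ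
    have hmeas : ∀ s < 0, AEStronglyMeasurable ((fun s => v (s - -τ / 2)) s) volume :=
      fun s hs => (hv.continuous_slice (t := s - -τ / 2) (by linarith)).aestronglyMeasurable
    obtain ⟨b, hb⟩ := hL _ hB hmeas (τ / 2) (by linarith)
    have e : τ / 2 - -τ / 2 = τ := by ring
    simp only [e] at hb
    exact ⟨b, (Continuous.ae_eq_iff_eq volume (hv.continuous_slice hτ) continuous_const).1 hb⟩
  choose! b hb using hconst
  exact hv.eq_zero_of_slice_const (b := b) (fun τ hτ y => by rw [hb τ hτ]) ht x

/-- **S6, the crux from the KNSS Liouville conjecture (L)** — indeed Type-I Liouville on the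
whole Albritton–Barker class, recurrence-free: assuming (L) (verbatim as in item `TypeIliouvilleL`
/ `LiouvilleConjectureNS`), every suitable weak solution `(u, p)` (`ν = 1`, `f = 0`) on the
backward slab with weak gradient `G`, `𝐈 < ⊤` and the rate `‖u(t,x)‖ ≤ C/√(−t)` is regular at
the origin: its continuous Oseen-mild representative is a Type-I ancient mild field, which (L)
kills (`satCL_typeIAncientMild_eq_zero`), so `u = 0` a.e. on the slab ⊇ `Q(0,1)`.
[cite: AlbrittonBarker2019, §1 after Thm 1.1] -/
theorem stub_satCruxOfLiouvilleL :
    (∀ v : ℝ → EuclideanSpace ℝ (Fin 3) → EuclideanSpace ℝ (Fin 3), IsBoundedAncientMildSolution 1 v →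
      (∀ t < 0, AEStronglyMeasurable (v t) volume) →
      ∀ t < 0, ∃ b : EuclideanSpace ℝ (Fin 3), v t =ᵐ[volume] fun _ => b) →
    ∀ (u : ℝ → EuclideanSpace ℝ (Fin 3) → EuclideanSpace ℝ (Fin 3))
      (p : ℝ → EuclideanSpace ℝ (Fin 3) → ℝ)
      (G : ℝ → EuclideanSpace ℝ (Fin 3) → EuclideanSpace ℝ (Fin 3) →L[ℝ] EuclideanSpace ℝ (Fin 3)) (C : ℝ),
      IsSuitableWeakSolutionOn (slab (EuclideanSpace ℝ (Fin 3)) (Iio 0) isOpen_Iio) 1 0 u p →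
      HasWeakSpatialGradientOn (slab (EuclideanSpace ℝ (Fin 3)) (Iio 0) isOpen_Iio) u G →
      typeIBound (Iio (0 : ℝ) ×ˢ univ) u p G < ⊤ → HasTypeITimeDecay C u →
      ¬ IsBackwardSingularPoint u 0 := by
  intro hL u p G C hsw _hwg hI hdec hsing
  obtain ⟨v, hae, hcont, hdiv, hmild, hrate⟩ := exists_oseenMild_repr_of_typeIBound_lt_top hsw hdec hI
  have hv : IsTypeIAncientMild C v := isTypeIAncientMild_of_continuous_oseenMild hcont hdiv hmild hrate
  -- `u = 0` a.e. on the open slab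
  have hzero : ∀ᵐ z ∂(volume.restrict (Iio (0 : ℝ) ×ˢ (univ : Set (EuclideanSpace ℝ (Fin 3))))),
      uncurry u z = 0 := by
    filter_upwards [hae, ae_restrict_mem (measurableSet_Iio.prod MeasurableSet.univ)] with z hz hzm
    rw [hz]
    exact satCL_typeIAncientMild_eq_zero hL hv (t := z.1) (by simpa using hzm.1) z.2
  -- hence on `Q(0,1)`, so the origin is regular
  have hQ : (uncurry u) =ᵐ[volume.restrict (parabolicCylinder 1 (0 : ℝ × EuclideanSpace ℝ (Fin 3)))] 0 :=
    ae_restrict_of_ae_restrict_of_subset (parabolicCylinder_origin_subset_slab 1) hzero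
  have h := hsing 1 one_pos
  rw [eLpNorm_congr_ae hQ, eLpNorm_zero] at h
  exact ENNReal.zero_ne_top h

end Summit.NavierStokesRegularity.NavierStokesRegularity.Theorems

end
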